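import Summits.QuantumFields.YangMills.Theorems.BalabanUVNodesN21GappedTopPair13CoPHCount
import Summits.QuantumFields.YangMills.Theorems.BalabanUVNodesN21GappedTopCut13CoPHSignFree

/-!
# N21 (NE7c) · THE GAPPED TOP CUT FOR BOTH INDICATOR FAMILIES WITHOUT THE SIGN ROWS: at NONPOSITIVE (3.3) letters the one (3.3) factor of a cube is LETTER-INDEPENDENT
# (its test `∀ b ∈ (□′^{∼2})^{(k)*}, |V_k(b)V^{(k)}_{□′}(b)⁻¹ − 1| < δ′` reads `∀ b ∈ (□′^{∼2})^{(k)*}, False` at every `δ′ ≤ 0` — NO nonemptiness of the starred bond family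
# needed), so the gapped (3.3) weights ARE the one-letter weights and the (3.3) collar count VANISHES; together with the lane owner's U8a (the (2.17) side at `ε ≤ 0`) the
# two-collar shell bounds, the majorants and the two common depths hold along the grids `ε(1−ρ)^i`, `2δ(1−ρ′)^j` for EITHER SIGN of `ε` and of `δ` — dial rows `0 ≤ ρ, ρ′ ≤ 1` only

WIDTH SEAT `pub-ymgap-dag-n21-w7` (g3), node N21 = NE7c (NOT PRINTED; NOT proved at print's fixed thresholds); lane K3⁸ `SpineGivenEndpointR13SepCoPHV`
(stmt-QuantumFields-27366, `--supports … --as helper`; COUNT-NEUTRAL).  THEOREMS ONLY (0 `def`).  The lane owner dag-n21-d g12's OFFER (cell bus 2026-08-28 13:12Z: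
«the pair faces can be made SIGN-FREE like U8a∕U8b … yours by lineage») taken.  Imports this seat's `…GappedTopPair13CoPHCount` (p627945: §Q3 `sum_topGap2ShellAt_le_majorants`,
§Q4 `sum_range_majorantA_le ∕ sum_range_majorantB_le`, §Q5; through it the definition lane `bFactorAt ∕ bGapAt ∕ collarBAt ∕ bCutGrid ∕ wGap2At ∕ topGap2SlotAt∕CoreAt∕ShellAt` and
(R) `topGap2ShellAt_nonneg`) and the lane owner's U8a `…GappedTopCut13CoPHSignFree` (p626047-lineage: `chiFactorAt_eq_zero_of_nonpos`, `aGapAt_eq_aWeightAt_of_nonpos`,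
`chiSeqOfRecordAt_succ_eq_of_nonpos`, `cutGrid_nonpos_of_neg`).  [III] = [Balaban1988Convergent].

WHY.  This seat's FILE 14∕15 (`…GappedTopPairReading13CoPH{,Faces}`) display both tops' `0 ≤ ε` and both old levels' `0 ≤ δ` AFTER `∀ g₀`; the K5 face `KeyedShellWeight cr`
quantifies over EVERY bare sequence `g₀` (junk included), so as ∀-rows they are refutable (dag-n21-d g12, LOCATED 13:34Z) — and they are used ONLY to make the two grids monotone.
At a negative base the grid is nonpositive and the corresponding family's objects are letter-independent, so the rows can be DROPPED (this file: NODE 00's generality; the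
companion `…GappedTopPairReading13CoPHSignFree`: the reading's faces).

WHAT THIS FILE PROVES ([folklore] bookkeeping; 0 `def`).
* §SF1 NONPOSITIVE (3.3) LETTERS: `smallApproxFluct_iff_of_nonpos` (the (3.3) test is the same proposition at any two nonpositive letters: `dist1 ≥ 0`), ★ `bFactorAt_eq_of_nonpos`
  (letter-independence on `(−∞, 0]`, cube by cube — `≡ 0` if the starred bond family is inhabited, `≡ 1` if empty, either way constant), `bGapAt_eq_bWeightAt_of_nonpos`,
  ★ `collarBAt_eq_zero_of_nonpos`, `bCutGrid_nonpos_of_neg`, `collarAt_eq_zero_of_nonpos` (the (2.17) twin, from U8a's `chiFactorAt_eq_zero_of_nonpos`).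
* §SF2 THE PAIR OBJECTS COLLAPSE: `wGap2At_eq_of_nonposA` (nonpositive (3.2) letters: the a-gap collapses onto the middle letter, U8a) · `wGap2At_eq_of_nonposB` (nonpositive (3.3)
  letters) · `topGap2SlotAt_eq_of_nonposB` · `topGap2CoreAt_eq_of_nonposA ∕ B` · ★ `topGap2ShellAt_eq_of_nonposA ∕ B` (the two-collar shell with a nonpositive letter triple in one
  family IS the shell with that family's collar CLOSED onto its middle letter).
* §SF3 ALONG THE GRIDS, ANY SIGNS (`0 ≤ ρ, ρ′ ≤ 1`; a-grid `cutGrid ν g ja ρ`, b-grid `bCutGrid ν A₁ g kb ρ′` at ANY base levels `ja, kb`): `cutGrid_dichotomy` ∕ `bCutGrid_dichotomy`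
  (monotone OR nonpositive), `collarAt_grid_nonneg` ∕ `collarBAt_grid_nonneg`, ★ `topGap2ShellAt_grids_nonneg` ((R) without the order rows), ★★ `sum_topGap2ShellAt_grids_le_majorants`
  (§Q3 without the order rows), `majorantA_grid_nonneg` ∕ `majorantB_grid_nonneg`, ★★★ `exists_common_depths_topGap2Shell_le_signFree` (§Q5 with the four sign rows REMOVED).

HONEST FRAMING (binding).  [folklore] bookkeeping over NODE 00's objects of record; the junk regimes `ε < 0` ∕ `δ < 0` are degenerate instances (every top (2.17) cube test fails ∕
every (3.3) cube test is decided by emptiness of the starred bond family alone), treated only so that the displayed rows shrink to the dial rows; NO estimate of Bałaban's asserted or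
used; NO anti-concentration; NE7c NOT PRINTED ∕ NOT proved at print's FIXED thresholds ((M1)-free only at SELECTED relative letters of the two top-step indicator families; the
residual `ζ` ∕ (3.5) and the levels below the top stay LOCATED); N21 NOT discharged; K3⁸ NOT claimed; counts UNMOVED (typed 28∕28 · discharged 5∕27, A 5∕28); never a count
claim.  No `sorry`, no `axiom`, no `def`, no `instance`, no `notation`.  One finite four-torus programme at fixed `ε` — NOT ℝ⁴, NOT OS, NOT a mass gap, NOT the Clay problem.
-/

noncomputable section

open scoped BigOperators
open Finset MeasureTheory

namespace Summit.QuantumFields.YangMills.Theorems.N21GappedTopPair13CoPH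

open Literature.MathematicalPhysics.QuantumFieldTheory.Balaban1983to89
open Literature.MathematicalPhysics.QuantumFieldTheory.Balaban1983to89.T4Continuum
open Literature.MathematicalPhysics.QuantumFieldTheory.Balaban1983to89.Node00
open Summit.QuantumFields.YangMills.BalabanUVNodes.N19MGFRoadLiveSelectorTower (dressedSlotsOfDatum₉_nonneg)
open Summit.QuantumFields.YangMills.BalabanUVNodes.N19MGFFormAtRecord (wOfRecord₉_nonneg)
open Summit.QuantumFields.YangMills.Theorems.N21ShellSplitOfRecord13CoPH
open Summit.QuantumFields.YangMills.Theorems.N21JointLetterSelection (exists_common_single_le)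
open B14.Sect3Decomp (SmallApproxFluct)

/-! ## §SF1 Nonpositive (3.3) letters: the one (3.3) factor is letter-independent, the gapped (3.3) weight IS the one-letter weight, the (3.3) collar count vanishes -/

section NonposB

variable (F : T4Family) (N : ℕ) [NeZero N] (ν : Stage7Numerics) (M : ℕ) (p : B12.RunParams) (g : ℕ → ℝ) (k : ℕ)

/-- **AT TWO NONPOSITIVE LETTERS THE (3.3) TEST OF A CUBE IS THE SAME PROPOSITION**: `δ₁, δ₂ ≤ 0 ⇒ (∀ b ∈ (□′^{∼2})^{(k)*}, dist1(…) < δ₁) ↔ (∀ b ∈ …, dist1(…) < δ₂)` — both read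
`∀ b ∈ (□′^{∼2})^{(k)*}, False` since `dist1 ≥ 0`; NO nonemptiness of the starred bond family is used. [bookkeeping] -/
theorem smallApproxFluct_iff_of_nonpos {δ₁ δ₂ : ℝ} (h₁ : δ₁ ≤ 0) (h₂ : δ₂ ≤ 0) (s : SeqOfRecord F ν M g p.K k) (c : Iχ F ν p g k)
    (U : GaugeField (F.P p.K) k (SU N)) (V' : GaugeField (F.P p.K) (k + 1) (SU N)) :
    SmallApproxFluct (sect3DataOfRecord F N ν M p g k s) (avOfRecord F N p.K) δ₁ U V' c ↔
      SmallApproxFluct (sect3DataOfRecord F N ν M p g k s) (avOfRecord F N p.K) δ₂ U V' c := by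
  unfold SmallApproxFluct
  exact forall₂_congr fun b _ =>
    ⟨fun h => absurd (h.trans_le h₁) (not_lt.2 (GaugeGroup.dist1_nonneg _)),
      fun h => absurd (h.trans_le h₂) (not_lt.2 (GaugeGroup.dist1_nonneg _))⟩

/-- ★ **THE ONE (3.3) FACTOR IS LETTER-INDEPENDENT ON `(−∞, 0]`**, cube by cube: `δ₁, δ₂ ≤ 0 ⇒ bFactor^{δ₁}_c = bFactor^{δ₂}_c` (`≡ 0` when the starred bond family of `c` is
inhabited, `≡ 1` when it is empty — either way the same at every nonpositive letter). [bookkeeping] -/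
theorem bFactorAt_eq_of_nonpos {δ₁ δ₂ : ℝ} (h₁ : δ₁ ≤ 0) (h₂ : δ₂ ≤ 0) (s : SeqOfRecord F ν M g p.K k) (c : Iχ F ν p g k)
    (U : GaugeField (F.P p.K) k (SU N)) (V' : GaugeField (F.P p.K) (k + 1) (SU N)) :
    bFactorAt F N ν M p g k δ₁ s c U V' = bFactorAt F N ν M p g k δ₂ s c U V' := by
  have key := smallApproxFluct_iff_of_nonpos F N ν M p g k h₁ h₂ s c U V'
  unfold bFactorAt
  by_cases h : SmallApproxFluct (sect3DataOfRecord F N ν M p g k s) (avOfRecord F N p.K) δ₁ U V' c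
  · rw [if_pos h, if_pos (key.1 h)]
  · rw [if_neg h, if_neg (fun h' => h (key.2 h'))]

/-- **AT NONPOSITIVE LETTERS THE GAPPED (3.3) WEIGHT IS THE ONE-LETTER WEIGHT**: `δlo, δ′, δhi ≤ 0 ⇒ bGap(δlo, δhi) = b|_{δ′}` (both product halves read letter-independent
factors). [bookkeeping] -/
theorem bGapAt_eq_bWeightAt_of_nonpos {δlo δ' δhi : ℝ} (hlo : δlo ≤ 0) (hδ : δ' ≤ 0) (hhi : δhi ≤ 0) (s : SeqOfRecord F ν M g p.K k)
    (Pl Ql : Finset (Iχ F ν p g k)) (U : GaugeField (F.P p.K) k (SU N)) (V' : GaugeField (F.P p.K) (k + 1) (SU N)) :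
    bGapAt F N ν M p g k δlo δhi s Pl Ql U V' = bWeightAt F N ν M p g k δ' s Pl Ql U V' := by
  by_cases hQ : Ql ⊆ qcubes F ν M p g k s Pl
  · rw [bGapAt_of_subset F N ν M p g k δlo δhi s hQ, bWeightAt_eq_prod F N ν M p g k δ' s hQ]
    have h1 : ∏ c ∈ qcubes F ν M p g k s Pl \ Ql, bFactorAt F N ν M p g k δlo s c U V' =
        ∏ c ∈ qcubes F ν M p g k s Pl \ Ql, bFactorAt F N ν M p g k δ' s c U V' :=
      Finset.prod_congr rfl fun c _ => bFactorAt_eq_of_nonpos F N ν M p g k hlo hδ s c U V'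
    have h2 : ∏ c ∈ Ql, (1 - bFactorAt F N ν M p g k δhi s c U V') = ∏ c ∈ Ql, (1 - bFactorAt F N ν M p g k δ' s c U V') :=
      Finset.prod_congr rfl fun c _ => by rw [bFactorAt_eq_of_nonpos F N ν M p g k hhi hδ s c U V']
    rw [h1, h2]
  · rw [bGapAt_of_not_subset F N ν M p g k δlo δhi s hQ, bWeightAt, if_neg hQ]

/-- ★ **AT NONPOSITIVE LETTERS THE (3.3) COLLAR COUNT VANISHES**: `δlo, δhi ≤ 0 ⇒ collarB(δlo, δhi) = 0` (no cube's (3.3) statistic separates two nonpositive letters).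
[bookkeeping] -/
theorem collarBAt_eq_zero_of_nonpos {δlo δhi : ℝ} (hlo : δlo ≤ 0) (hhi : δhi ≤ 0) (s : SeqOfRecord F ν M g p.K k) (U : GaugeField (F.P p.K) k (SU N))
    (V' : GaugeField (F.P p.K) (k + 1) (SU N)) : collarBAt F N ν M p g k δlo δhi s U V' = 0 :=
  Finset.sum_eq_zero fun c _ => by rw [bFactorAt_eq_of_nonpos F N ν M p g k hhi hlo s c U V', sub_self]

end NonposB

/-- along the (3.3) grid with a NEGATIVE base `δ_k < 0` every letter is nonpositive (`ρ′ ≤ 1`). [bookkeeping] -/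
theorem bCutGrid_nonpos_of_neg (ν : Stage7Numerics) (A₁ : ℝ) (g : ℕ → ℝ) (kb : ℕ) (hδ : deltaOfRecord ν g kb A₁ < 0) {ρ' : ℝ} (hρ'1 : ρ' ≤ 1) (j : ℕ) :
    bCutGrid ν A₁ g kb ρ' j ≤ 0 := by
  unfold bCutGrid
  exact mul_nonpos_of_nonpos_of_nonneg (by linarith) (pow_nonneg (by linarith) j)

/-- along the (3.3) grid with a nonnegative base every letter is nonnegative (`ρ′ ≤ 1`). [bookkeeping] -/
theorem bCutGrid_nonneg_of_nonneg (ν : Stage7Numerics) (A₁ : ℝ) (g : ℕ → ℝ) (kb : ℕ) (hδ : 0 ≤ deltaOfRecord ν g kb A₁) {ρ' : ℝ} (hρ'1 : ρ' ≤ 1) (j : ℕ) :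
    0 ≤ bCutGrid ν A₁ g kb ρ' j := by
  unfold bCutGrid
  exact mul_nonneg (by linarith) (pow_nonneg (by linarith) j)

/-- **THE (3.3) GRID DICHOTOMY**: for `0 ≤ ρ′ ≤ 1` the grid `2δ_{kb}(1−ρ′)^j` is EITHER non-increasing in `j` (`0 ≤ δ_{kb}`) OR nonpositive termwise (`δ_{kb} < 0`). [bookkeeping] -/
theorem bCutGrid_dichotomy (ν : Stage7Numerics) (A₁ : ℝ) (g : ℕ → ℝ) (kb : ℕ) {ρ' : ℝ} (hρ'0 : 0 ≤ ρ') (hρ'1 : ρ' ≤ 1) :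
    (∀ j, bCutGrid ν A₁ g kb ρ' (j + 1) ≤ bCutGrid ν A₁ g kb ρ' j) ∨ (∀ j, bCutGrid ν A₁ g kb ρ' j ≤ 0) := by
  rcases le_or_gt 0 (deltaOfRecord ν g kb A₁) with hδ | hδ
  · exact Or.inl fun j => bCutGrid_succ_le_of_nonneg ν A₁ g kb hδ hρ'0 hρ'1 j
  · exact Or.inr fun j => bCutGrid_nonpos_of_neg ν A₁ g kb hδ hρ'1 j

/-- **THE (3.2) GRID DICHOTOMY**: for `0 ≤ ρ ≤ 1` the grid `ε_{ja}(1−ρ)^i` is EITHER non-increasing in `i` (`0 ≤ ε_{ja}`) OR nonpositive termwise (`ε_{ja} < 0`). [bookkeeping] -/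
theorem cutGrid_dichotomy (ν : Stage7Numerics) (g : ℕ → ℝ) (ja : ℕ) {ρ : ℝ} (hρ0 : 0 ≤ ρ) (hρ1 : ρ ≤ 1) :
    (∀ i, cutGrid ν g ja ρ (i + 1) ≤ cutGrid ν g ja ρ i) ∨ (∀ i, cutGrid ν g ja ρ i ≤ 0) := by
  rcases le_or_gt 0 (epsOfRecord ν g ja) with hε | hε
  · exact Or.inl fun i => cutGrid_succ_le_of_nonneg ν ja hε hρ0 hρ1 i
  · exact Or.inr fun i => cutGrid_nonpos_of_neg hε hρ1 i

/-! ## §SF2 The pair objects at nonpositive letters: each family's open collar closes onto its middle letter -/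

section Collapse

variable (F : T4Family) (N : ℕ) [NeZero N] (ϑ : Stage9Params F N) (D : FiniteEpsData F (SU N)) (g₀ : ℕ → ℝ) (os : List (ULoop F))
  (p : B12.RunParams) (g : ℕ → ℝ) (k : ℕ)

/-- the (2.17) collar count vanishes at nonpositive letters (U8a `chiFactorAt_eq_zero_of_nonpos` termwise). [bookkeeping] -/
theorem collarAt_eq_zero_of_nonpos {θlo θhi : ℝ} (hlo : θlo ≤ 0) (hhi : θhi ≤ 0) (V' : GaugeField (F.P p.K) (k + 1) (SU N)) :
    collarAt F N ϑ.ν p g k θlo θhi V' = 0 :=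
  Finset.sum_eq_zero fun c _ => by
    rw [chiFactorAt_eq_zero_of_nonpos F N ϑ p g k hhi c V', chiFactorAt_eq_zero_of_nonpos F N ϑ p g k hlo c V', sub_self]

/-- **a-COLLAPSE OF THE DOUBLY-GAPPED STEP WEIGHTS**: at nonpositive (3.2) letters `θlo, θ, θhi ≤ 0`, `wGap2(θlo, θhi; δlo, δhi) = wGap2(θ, θ; δlo, δhi)` (U8a's
`aGapAt_eq_aWeightAt_of_nonpos` inside the resummation; every step, any (3.3) letters). [bookkeeping] -/
theorem wGap2At_eq_of_nonposA {θlo θ θhi : ℝ} (hlo : θlo ≤ 0) (hθ : θ ≤ 0) (hhi : θhi ≤ 0) (δlo δhi : ℝ)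
    (s' : SeqOfRecord F ϑ.ν ϑ.τ9.M g p.K (k + 1)) (U : GaugeField (F.P p.K) k (SU N)) (V' : GaugeField (F.P p.K) (k + 1) (SU N)) :
    wGap2At F N ϑ θlo θhi δlo δhi p g k s' U V' = wGap2At F N ϑ θ θ δlo δhi p g k s' U V' := by
  classical
  rw [wGap2At_apply, wGap2At_apply]
  unfold resumWeights
  refine Finset.sum_congr rfl fun t _ => ?_
  unfold ωGap2At
  rw [aGapAt_eq_aWeightAt_of_nonpos F N ϑ p g k hlo hθ hhi, aGapAt_eq_aWeightAt_of_nonpos F N ϑ p g k hθ hθ hθ]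

/-- **b-COLLAPSE OF THE DOUBLY-GAPPED STEP WEIGHTS**: at nonpositive (3.3) letters `δlo, δ′, δhi ≤ 0`, `wGap2(θlo, θhi; δlo, δhi) = wGap2(θlo, θhi; δ′, δ′)` (§SF1 inside the
resummation; every step, any (3.2) letters). [bookkeeping] -/
theorem wGap2At_eq_of_nonposB (θlo θhi : ℝ) {δlo δ' δhi : ℝ} (hlo : δlo ≤ 0) (hδ : δ' ≤ 0) (hhi : δhi ≤ 0)
    (s' : SeqOfRecord F ϑ.ν ϑ.τ9.M g p.K (k + 1)) (U : GaugeField (F.P p.K) k (SU N)) (V' : GaugeField (F.P p.K) (k + 1) (SU N)) :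
    wGap2At F N ϑ θlo θhi δlo δhi p g k s' U V' = wGap2At F N ϑ θlo θhi δ' δ' p g k s' U V' := by
  classical
  rw [wGap2At_apply, wGap2At_apply]
  unfold resumWeights
  refine Finset.sum_congr rfl fun t _ => ?_
  unfold ωGap2At
  rw [bGapAt_eq_bWeightAt_of_nonpos F N ϑ.ν ϑ.τ9.M p g k hlo hδ hhi, bGapAt_eq_bWeightAt_of_nonpos F N ϑ.ν ϑ.τ9.M p g k hδ hδ hδ]

/-- b-collapse of the doubly-gapped top slot. [bookkeeping] -/
theorem topGap2SlotAt_eq_of_nonposB (θlo θhi : ℝ) {δlo δ' δhi : ℝ} (hlo : δlo ≤ 0) (hδ : δ' ≤ 0) (hhi : δhi ≤ 0) (t : ℝ)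
    (s' : SeqOfRecord F ϑ.ν ϑ.τ9.M g p.K (k + 1)) (V : GaugeField (F.P p.K) (k + 1) (SU N)) :
    topGap2SlotAt F N ϑ D g₀ os p g k θlo θhi δlo δhi t s' V = topGap2SlotAt F N ϑ D g₀ os p g k θlo θhi δ' δ' t s' V := by
  rw [topGap2SlotAt_apply, topGap2SlotAt_apply]
  have hw : (fun U => wGap2At F N ϑ θlo θhi δlo δhi p g k s' U V *
        (chiSeqOfRecordAt F N ϑ.ν ϑ.τ9.M g p.K k (topLetter ϑ.ν θlo p g k) s'.init U * dressedSlotsOfDatum₉ F N ϑ D g₀ os t p g k s'.init U)) =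
      (fun U => wGap2At F N ϑ θlo θhi δ' δ' p g k s' U V *
        (chiSeqOfRecordAt F N ϑ.ν ϑ.τ9.M g p.K k (topLetter ϑ.ν θlo p g k) s'.init U * dressedSlotsOfDatum₉ F N ϑ D g₀ os t p g k s'.init U)) :=
    funext fun U => by rw [wGap2At_eq_of_nonposB F N ϑ p g k θlo θhi hlo hδ hhi s' U V]
  rw [hw]

/-- b-collapse of the doubly-gapped core. [bookkeeping] -/
theorem topGap2CoreAt_eq_of_nonposB (θlo θhi : ℝ) {δlo δ' δhi : ℝ} (hlo : δlo ≤ 0) (hδ : δ' ≤ 0) (hhi : δhi ≤ 0) (t : ℝ)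
    (s' : SeqOfRecord F ϑ.ν ϑ.τ9.M g p.K (k + 1)) :
    topGap2CoreAt F N ϑ D g₀ os p g k θlo θhi δlo δhi t s' = topGap2CoreAt F N ϑ D g₀ os p g k θlo θhi δ' δ' t s' := by
  unfold topGap2CoreAt
  exact integral_congr_ae (ae_of_all _ fun V => by
    dsimp only
    rw [topGap2SlotAt_eq_of_nonposB F N ϑ D g₀ os p g k θlo θhi hlo hδ hhi t s' V])

/-- ★ **b-COLLAPSE OF THE TWO-COLLAR SHELL**: at nonpositive (3.3) letters the shell with the (3.3) collar `(δlo, δhi)` IS the shell with that collar closed onto `δ′`. [bookkeeping] -/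
theorem topGap2ShellAt_eq_of_nonposB (θlo θ θhi : ℝ) {δlo δ' δhi : ℝ} (hlo : δlo ≤ 0) (hδ : δ' ≤ 0) (hhi : δhi ≤ 0) (t : ℝ)
    (s' : SeqOfRecord F ϑ.ν ϑ.τ9.M g p.K (k + 1)) :
    topGap2ShellAt F N ϑ D g₀ os p g k θlo θ θhi δlo δ' δhi t s' = topGap2ShellAt F N ϑ D g₀ os p g k θlo θ θhi δ' δ' δ' t s' := by
  unfold topGap2ShellAt
  rw [topGap2CoreAt_eq_of_nonposB F N ϑ D g₀ os p g k θlo θhi hlo hδ hhi t s']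

/-- a-collapse of the doubly-gapped core (at the run's top `k + 1 = p.K`: the new front factor `χ^{θlo}_{k+1}` is letter-independent on `(−∞, 0]` by U8a's
`chiSeqOfRecordAt_succ_eq_of_nonpos`, the old front factor reads print's `ε_k` either way). [bookkeeping] -/
theorem topGap2CoreAt_eq_of_nonposA (hk : k + 1 = p.K) {θlo θ θhi : ℝ} (hlo : θlo ≤ 0) (hθ : θ ≤ 0) (hhi : θhi ≤ 0) (δlo δhi t : ℝ)
    (s' : SeqOfRecord F ϑ.ν ϑ.τ9.M g p.K (k + 1)) :
    topGap2CoreAt F N ϑ D g₀ os p g k θlo θhi δlo δhi t s' = topGap2CoreAt F N ϑ D g₀ os p g k θ θ δlo δhi t s' := by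
  have hk' : k < p.K := by omega
  unfold topGap2CoreAt
  refine integral_congr_ae (ae_of_all _ fun V => ?_)
  dsimp only
  rw [chiSeqOfRecordAt_succ_eq_of_nonpos F N ϑ p g k hlo hθ s' V, topGap2SlotAt_apply, topGap2SlotAt_apply,
    chiSeqOfRecordAt_topLetter_of_lt F N ϑ p g k hk' θlo, chiSeqOfRecordAt_topLetter_of_lt F N ϑ p g k hk' θ]
  have hw : (fun U => wGap2At F N ϑ θlo θhi δlo δhi p g k s' U V *
        (chiSeqOfRecord F N ϑ.ν ϑ.τ9.M g p.K k s'.init U * dressedSlotsOfDatum₉ F N ϑ D g₀ os t p g k s'.init U)) =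
      (fun U => wGap2At F N ϑ θ θ δlo δhi p g k s' U V *
        (chiSeqOfRecord F N ϑ.ν ϑ.τ9.M g p.K k s'.init U * dressedSlotsOfDatum₉ F N ϑ D g₀ os t p g k s'.init U)) :=
    funext fun U => by rw [wGap2At_eq_of_nonposA F N ϑ p g k hlo hθ hhi δlo δhi s' U V]
  rw [hw]

/-- ★ **a-COLLAPSE OF THE TWO-COLLAR SHELL** (at the run's top): at nonpositive (3.2) letters `θlo, θ, θhi ≤ 0` the shell with the (3.2) collar `(θlo, θhi)` IS the shell with that
collar closed onto `θ`. [bookkeeping] -/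
theorem topGap2ShellAt_eq_of_nonposA (hk : k + 1 = p.K) {θlo θ θhi : ℝ} (hlo : θlo ≤ 0) (hθ : θ ≤ 0) (hhi : θhi ≤ 0) (δlo δ' δhi t : ℝ)
    (s' : SeqOfRecord F ϑ.ν ϑ.τ9.M g p.K (k + 1)) :
    topGap2ShellAt F N ϑ D g₀ os p g k θlo θ θhi δlo δ' δhi t s' = topGap2ShellAt F N ϑ D g₀ os p g k θ θ θ δlo δ' δhi t s' := by
  unfold topGap2ShellAt
  rw [topGap2CoreAt_eq_of_nonposA F N ϑ D g₀ os p g k hk hlo hθ hhi δlo δhi t s']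

end Collapse

/-! ## §SF3 Along the two grids, ANY signs of `ε_{ja}` and `δ_{kb}`: (R), the majorant bound, the majorants' signs, the two common depths -/

section Grids

variable (F : T4Family) (N : ℕ) [NeZero N] (ϑ : Stage9Params F N) (D : FiniteEpsData F (SU N)) (g₀ : ℕ → ℝ) (os : List (ULoop F))
  (p : B12.RunParams) (g : ℕ → ℝ) (k : ℕ)

/-- `0 ≤` the (2.17) collar count of a grid collar `(θ_{i+2}, θ_i)`, ANY sign of the base (monotone case: U1 `collarAt_nonneg`; nonpositive case: the count is `0`). [bookkeeping] -/
theorem collarAt_grid_nonneg (ja : ℕ) {ρ : ℝ} (hρ0 : 0 ≤ ρ) (hρ1 : ρ ≤ 1) (i : ℕ) (V' : GaugeField (F.P p.K) (k + 1) (SU N)) :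
    0 ≤ collarAt F N ϑ.ν p g k (cutGrid ϑ.ν g ja ρ (i + 2)) (cutGrid ϑ.ν g ja ρ i) V' := by
  rcases cutGrid_dichotomy ϑ.ν g ja hρ0 hρ1 with hθ | hθ
  · exact collarAt_nonneg F N ϑ.ν p g k ((hθ (i + 1)).trans (hθ i)) V'
  · rw [collarAt_eq_zero_of_nonpos F N ϑ p g k (hθ _) (hθ _) V']

/-- `0 ≤` the (3.3) collar count of a grid collar `(δ′_{j+2}, δ′_j)`, ANY sign of the base. [bookkeeping] -/
theorem collarBAt_grid_nonneg (kb : ℕ) {ρ' : ℝ} (hρ'0 : 0 ≤ ρ') (hρ'1 : ρ' ≤ 1) (j : ℕ) (s : SeqOfRecord F ϑ.ν ϑ.τ9.M g p.K k)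
    (U : GaugeField (F.P p.K) k (SU N)) (V' : GaugeField (F.P p.K) (k + 1) (SU N)) :
    0 ≤ collarBAt F N ϑ.ν ϑ.τ9.M p g k (bCutGrid ϑ.ν ϑ.A₁ g kb ρ' (j + 2)) (bCutGrid ϑ.ν ϑ.A₁ g kb ρ' j) s U V' := by
  rcases bCutGrid_dichotomy ϑ.ν ϑ.A₁ g kb hρ'0 hρ'1 with hδ | hδ
  · exact collarBAt_nonneg F N ϑ.ν ϑ.τ9.M p g k ((hδ (j + 1)).trans (hδ j)) s U V'
  · rw [collarBAt_eq_zero_of_nonpos F N ϑ.ν ϑ.τ9.M p g k (hδ _) (hδ _) s U V']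

/-- **THE a-LETTERS OF A GRID COLLAR CLOSE OR ARE ORDERED**: for `0 ≤ ρ ≤ 1` there are `θlo ≤ θ_{i+1} ≤ θhi` with the two-collar shell at `(θ_{i+2}, θ_{i+1}, θ_i; ·)` EQUAL to the
shell at `(θlo, θ_{i+1}, θhi; ·)` (history by history) and `collarA(θ_{i+2}, θ_i) = collarA(θlo, θhi)` — the letters themselves if `0 ≤ ε_{ja}`, the closed collar
`θlo = θhi = θ_{i+1}` if `ε_{ja} < 0` (§SF2, at the run's top). [bookkeeping] -/
theorem cutGrid_collar_ordered (hk : k + 1 = p.K) (ja : ℕ) {ρ : ℝ} (hρ0 : 0 ≤ ρ) (hρ1 : ρ ≤ 1) (i : ℕ) :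
    ∃ θlo θhi : ℝ, θlo ≤ cutGrid ϑ.ν g ja ρ (i + 1) ∧ cutGrid ϑ.ν g ja ρ (i + 1) ≤ θhi ∧
      (∀ (δlo δ' δhi t : ℝ) (s' : SeqOfRecord F ϑ.ν ϑ.τ9.M g p.K (k + 1)),
        topGap2ShellAt F N ϑ D g₀ os p g k (cutGrid ϑ.ν g ja ρ (i + 2)) (cutGrid ϑ.ν g ja ρ (i + 1)) (cutGrid ϑ.ν g ja ρ i) δlo δ' δhi t s' =
          topGap2ShellAt F N ϑ D g₀ os p g k θlo (cutGrid ϑ.ν g ja ρ (i + 1)) θhi δlo δ' δhi t s') ∧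
      collarAt F N ϑ.ν p g k (cutGrid ϑ.ν g ja ρ (i + 2)) (cutGrid ϑ.ν g ja ρ i) = collarAt F N ϑ.ν p g k θlo θhi := by
  rcases cutGrid_dichotomy ϑ.ν g ja hρ0 hρ1 with hθ | hθ
  · exact ⟨cutGrid ϑ.ν g ja ρ (i + 2), cutGrid ϑ.ν g ja ρ i, hθ (i + 1), hθ i, fun _ _ _ _ _ => rfl, rfl⟩
  · refine ⟨cutGrid ϑ.ν g ja ρ (i + 1), cutGrid ϑ.ν g ja ρ (i + 1), le_rfl, le_rfl, fun δlo δ' δhi t s' =>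
      topGap2ShellAt_eq_of_nonposA F N ϑ D g₀ os p g k hk (hθ _) (hθ _) (hθ _) δlo δ' δhi t s', funext fun V' => ?_⟩
    rw [collarAt_eq_zero_of_nonpos F N ϑ p g k (hθ _) (hθ _) V', collarAt_eq_zero_of_nonpos F N ϑ p g k (hθ _) (hθ _) V']

/-- **THE b-LETTERS OF A GRID COLLAR CLOSE OR ARE ORDERED** (any base level `kb`, any (3.2) letters; every step). [bookkeeping] -/
theorem bCutGrid_collar_ordered (kb : ℕ) {ρ' : ℝ} (hρ'0 : 0 ≤ ρ') (hρ'1 : ρ' ≤ 1) (j : ℕ) :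
    ∃ δlo δhi : ℝ, δlo ≤ bCutGrid ϑ.ν ϑ.A₁ g kb ρ' (j + 1) ∧ bCutGrid ϑ.ν ϑ.A₁ g kb ρ' (j + 1) ≤ δhi ∧
      (∀ (θlo θ θhi t : ℝ) (s' : SeqOfRecord F ϑ.ν ϑ.τ9.M g p.K (k + 1)),
        topGap2ShellAt F N ϑ D g₀ os p g k θlo θ θhi (bCutGrid ϑ.ν ϑ.A₁ g kb ρ' (j + 2)) (bCutGrid ϑ.ν ϑ.A₁ g kb ρ' (j + 1))
            (bCutGrid ϑ.ν ϑ.A₁ g kb ρ' j) t s' =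
          topGap2ShellAt F N ϑ D g₀ os p g k θlo θ θhi δlo (bCutGrid ϑ.ν ϑ.A₁ g kb ρ' (j + 1)) δhi t s') ∧
      collarBAt F N ϑ.ν ϑ.τ9.M p g k (bCutGrid ϑ.ν ϑ.A₁ g kb ρ' (j + 2)) (bCutGrid ϑ.ν ϑ.A₁ g kb ρ' j) =
        collarBAt F N ϑ.ν ϑ.τ9.M p g k δlo δhi := by
  rcases bCutGrid_dichotomy ϑ.ν ϑ.A₁ g kb hρ'0 hρ'1 with hδ | hδ
  · exact ⟨bCutGrid ϑ.ν ϑ.A₁ g kb ρ' (j + 2), bCutGrid ϑ.ν ϑ.A₁ g kb ρ' j, hδ (j + 1), hδ j, fun _ _ _ _ _ => rfl, rfl⟩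
  · refine ⟨bCutGrid ϑ.ν ϑ.A₁ g kb ρ' (j + 1), bCutGrid ϑ.ν ϑ.A₁ g kb ρ' (j + 1), le_rfl, le_rfl, fun θlo θ θhi t s' =>
      topGap2ShellAt_eq_of_nonposB F N ϑ D g₀ os p g k θlo θ θhi (hδ _) (hδ _) (hδ _) t s', funext fun s => funext fun U => funext fun V' => ?_⟩
    rw [collarBAt_eq_zero_of_nonpos F N ϑ.ν ϑ.τ9.M p g k (hδ _) (hδ _) s U V', collarBAt_eq_zero_of_nonpos F N ϑ.ν ϑ.τ9.M p g k (hδ _) (hδ _) s U V']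

/-- ★ (R) **`0 ≤` THE TWO-COLLAR SHELL ALONG THE GRIDS, ANY SIGNS** (`0 ≤ ρ, ρ′ ≤ 1`; rows: the top `k + 1 = p.K`, `0 ≤ ζ`, `Σ|ζ| ≤ 1`, (H-ζ), (e1) at level `k`) — this seat's
`topGap2ShellAt_nonneg` with the order rows replaced by the grids (close each negative-base collar, then the ordered lemma). [bookkeeping] -/
theorem topGap2ShellAt_grids_nonneg (hk : k + 1 = p.K) (hζ0 : ∀ p g k s Pl Ql RS U V', 0 ≤ ϑ.ζ p g k s Pl Ql RS U V') (hζm : ZetaMeasurable F N ϑ.ζ)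
    (hζ1 : IsZetaAbsLeOne F N ϑ.ν ϑ.τ9.M ϑ.ζ) {ρ ρ' : ℝ} (hρ0 : 0 ≤ ρ) (hρ1 : ρ ≤ 1) (hρ'0 : 0 ≤ ρ') (hρ'1 : ρ' ≤ 1) (ja kb i j : ℕ) (t : ℝ)
    (hint : ∀ s : SeqOfRecord F ϑ.ν ϑ.τ9.M g p.K k,
      Integrable (fun U => chiSeqOfRecord F N ϑ.ν ϑ.τ9.M g p.K k s U * dressedSlotsOfDatum₉ F N ϑ D g₀ os t p g k s U) (fieldMeasure (F.P p.K) k (SU N)))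
    (s' : SeqOfRecord F ϑ.ν ϑ.τ9.M g p.K (k + 1)) :
    0 ≤ topGap2ShellAt F N ϑ D g₀ os p g k (cutGrid ϑ.ν g ja ρ (i + 2)) (cutGrid ϑ.ν g ja ρ (i + 1)) (cutGrid ϑ.ν g ja ρ i)
      (bCutGrid ϑ.ν ϑ.A₁ g kb ρ' (j + 2)) (bCutGrid ϑ.ν ϑ.A₁ g kb ρ' (j + 1)) (bCutGrid ϑ.ν ϑ.A₁ g kb ρ' j) t s' := by
  obtain ⟨θlo, θhi, hθlo, hθhi, hshA, -⟩ := cutGrid_collar_ordered F N ϑ D g₀ os p g k hk ja hρ0 hρ1 i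
  obtain ⟨δlo, δhi, hδlo, hδhi, hshB, -⟩ := bCutGrid_collar_ordered F N ϑ D g₀ os p g k kb hρ'0 hρ'1 j
  rw [hshA, hshB]
  exact topGap2ShellAt_nonneg F N ϑ D g₀ os p g k hk hζ0 hζm hζ1 hθlo hθhi hδlo hδhi t hint s'

/-- ★★ **THE TWO-COLLAR SHELLS ALONG THE GRIDS ARE BELOW THE a-MAJORANT PLUS THE b-MAJORANT, ANY SIGNS** — this seat's §Q3 `sum_topGap2ShellAt_le_majorants` with the order rows
replaced by the grids: a negative-base collar is closed (§SF2) and its majorant is the (vanishing) one of the grid collar. [bookkeeping] -/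
theorem sum_topGap2ShellAt_grids_le_majorants (hk : k + 1 = p.K) (hζ0 : ∀ p g k s Pl Ql RS U V', 0 ≤ ϑ.ζ p g k s Pl Ql RS U V') (hζm : ZetaMeasurable F N ϑ.ζ)
    (hζ1 : IsZetaAbsLeOne F N ϑ.ν ϑ.τ9.M ϑ.ζ) (hζu : IsZetaUnity F N ϑ.ν ϑ.τ9.M ϑ.ζ) {ρ ρ' : ℝ} (hρ0 : 0 ≤ ρ) (hρ1 : ρ ≤ 1) (hρ'0 : 0 ≤ ρ') (hρ'1 : ρ' ≤ 1)
    (ja kb i j : ℕ) (t : ℝ)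
    (hint : ∀ s : SeqOfRecord F ϑ.ν ϑ.τ9.M g p.K k,
      Integrable (fun U => chiSeqOfRecord F N ϑ.ν ϑ.τ9.M g p.K k s U * dressedSlotsOfDatum₉ F N ϑ D g₀ os t p g k s U) (fieldMeasure (F.P p.K) k (SU N))) :
    ∑ s', topGap2ShellAt F N ϑ D g₀ os p g k (cutGrid ϑ.ν g ja ρ (i + 2)) (cutGrid ϑ.ν g ja ρ (i + 1)) (cutGrid ϑ.ν g ja ρ i)
        (bCutGrid ϑ.ν ϑ.A₁ g kb ρ' (j + 2)) (bCutGrid ϑ.ν ϑ.A₁ g kb ρ' (j + 1)) (bCutGrid ϑ.ν ϑ.A₁ g kb ρ' j) t s' ≤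
      (∫ U, collarAt F N ϑ.ν p g k (cutGrid ϑ.ν g ja ρ (i + 2)) (cutGrid ϑ.ν g ja ρ i) ((avOfRecord F N p.K k).avg U) *
          ∑ s, chiSeqOfRecord F N ϑ.ν ϑ.τ9.M g p.K k s U * dressedSlotsOfDatum₉ F N ϑ D g₀ os t p g k s U ∂fieldMeasure (F.P p.K) k (SU N)) +
        ∫ U, ∑ s, collarBAt F N ϑ.ν ϑ.τ9.M p g k (bCutGrid ϑ.ν ϑ.A₁ g kb ρ' (j + 2)) (bCutGrid ϑ.ν ϑ.A₁ g kb ρ' j) s U ((avOfRecord F N p.K k).avg U) *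
          (chiSeqOfRecord F N ϑ.ν ϑ.τ9.M g p.K k s U * dressedSlotsOfDatum₉ F N ϑ D g₀ os t p g k s U) ∂fieldMeasure (F.P p.K) k (SU N) := by
  obtain ⟨θlo, θhi, hθlo, hθhi, hshA, hcolA⟩ := cutGrid_collar_ordered F N ϑ D g₀ os p g k hk ja hρ0 hρ1 i
  obtain ⟨δlo, δhi, hδlo, hδhi, hshB, hcolB⟩ := bCutGrid_collar_ordered F N ϑ D g₀ os p g k kb hρ'0 hρ'1 j
  simp only [hshA, hshB]
  rw [hcolA, hcolB]
  exact sum_topGap2ShellAt_le_majorants F N ϑ D g₀ os p g k hk hζ0 hζm hζ1 hζu hθlo hθhi hδlo hδhi t hint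

/-- `0 ≤` the a-majorant of a grid collar, ANY sign of the base (`0 ≤ ζ` for the old pieces). [bookkeeping] -/
theorem majorantA_grid_nonneg (hζ0 : ∀ p g k s Pl Ql RS U V', 0 ≤ ϑ.ζ p g k s Pl Ql RS U V') (ja : ℕ) {ρ : ℝ} (hρ0 : 0 ≤ ρ) (hρ1 : ρ ≤ 1) (i : ℕ) (t : ℝ) :
    0 ≤ ∫ U, collarAt F N ϑ.ν p g k (cutGrid ϑ.ν g ja ρ (i + 2)) (cutGrid ϑ.ν g ja ρ i) ((avOfRecord F N p.K k).avg U) *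
      ∑ s, chiSeqOfRecord F N ϑ.ν ϑ.τ9.M g p.K k s U * dressedSlotsOfDatum₉ F N ϑ D g₀ os t p g k s U ∂fieldMeasure (F.P p.K) k (SU N) :=
  integral_nonneg fun U => mul_nonneg (collarAt_grid_nonneg F N ϑ p g k ja hρ0 hρ1 i _) (Finset.sum_nonneg fun s _ =>
    mul_nonneg (chiSeqOfRecord_nonneg F N ϑ.ν ϑ.τ9.M g p.K k s U) (dressedSlotsOfDatum₉_nonneg F N ϑ D g₀ os p g (wOfRecord₉_nonneg ϑ hζ0 p g) t k s U))

/-- `0 ≤` the b-majorant of a grid collar, ANY sign of the base. [bookkeeping] -/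
theorem majorantB_grid_nonneg (hζ0 : ∀ p g k s Pl Ql RS U V', 0 ≤ ϑ.ζ p g k s Pl Ql RS U V') (kb : ℕ) {ρ' : ℝ} (hρ'0 : 0 ≤ ρ') (hρ'1 : ρ' ≤ 1) (j : ℕ) (t : ℝ) :
    0 ≤ ∫ U, ∑ s, collarBAt F N ϑ.ν ϑ.τ9.M p g k (bCutGrid ϑ.ν ϑ.A₁ g kb ρ' (j + 2)) (bCutGrid ϑ.ν ϑ.A₁ g kb ρ' j) s U ((avOfRecord F N p.K k).avg U) *
      (chiSeqOfRecord F N ϑ.ν ϑ.τ9.M g p.K k s U * dressedSlotsOfDatum₉ F N ϑ D g₀ os t p g k s U) ∂fieldMeasure (F.P p.K) k (SU N) :=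
  integral_nonneg fun U => Finset.sum_nonneg fun s _ => mul_nonneg (collarBAt_grid_nonneg F N ϑ p g k kb hρ'0 hρ'1 j s U _)
    (mul_nonneg (chiSeqOfRecord_nonneg F N ϑ.ν ϑ.τ9.M g p.K k s U) (dressedSlotsOfDatum₉_nonneg F N ϑ D g₀ os p g (wOfRecord₉_nonneg ϑ hζ0 p g) t k s U))

end Grids

/-! ### §Q5 sign-free: the two depths, selected SEPARATELY, common to two runs — (M1)-FREE, NO sign row -/

section SelectSF

variable (F : T4Family) (N : ℕ) [NeZero N] (ϑ : Stage9Params F N) (D : FiniteEpsData F (SU N)) (g₀ : ℕ → ℝ) (os : List (ULoop F))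

/-- ★★★ **TWO RUNS OF THE SAME TUPLE, ONE COMMON (3.2) DEPTH AND ONE COMMON (3.3) DEPTH — ANY SIGNS OF THE TWO `ε_top`'s AND THE TWO `δ_old`'s**: this seat's §Q5
`exists_common_depths_topGap2Shell_le` with its four sign rows `0 ≤ ε_top`, `0 ≤ δ_old` REMOVED (widths `ρ, ρ′ ∈ [0,1]`, budgets `n₁, n₂`, one source `t`; run `r` at its top
`k_r + 1 = p_r.K`): some `i ≤ n₁` AND some `j ≤ n₂`, the SAME for both runs, have
`Σ_{s′} shell2ʳ(θʳ_{i+2}, θʳ_{i+1}, θʳ_i; δ′ʳ_{j+2}, δ′ʳ_{j+1}, δ′ʳ_j) ≤ 4(2L^m)⁴·(1∕(n₁+1) + 1∕(n₂+1))·Σ_s classWeightʳ_{k_r}(s)` in EACH run.  NO anti-concentration, NO estimate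
of Bałaban's. [bookkeeping] -/
theorem exists_common_depths_topGap2Shell_le_signFree (p₁ : B12.RunParams) (g₁ : ℕ → ℝ) (k₁ : ℕ) (hk₁ : k₁ + 1 = p₁.K) (p₂ : B12.RunParams) (g₂ : ℕ → ℝ)
    (k₂ : ℕ) (hk₂ : k₂ + 1 = p₂.K)
    (hζ0 : ∀ p g k s Pl Ql RS U V', 0 ≤ ϑ.ζ p g k s Pl Ql RS U V') (hζm : ZetaMeasurable F N ϑ.ζ) (hζ1 : IsZetaAbsLeOne F N ϑ.ν ϑ.τ9.M ϑ.ζ)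
    (hζu : IsZetaUnity F N ϑ.ν ϑ.τ9.M ϑ.ζ) {ρ ρ' : ℝ} (hρ0 : 0 ≤ ρ) (hρ1 : ρ ≤ 1) (hρ'0 : 0 ≤ ρ') (hρ'1 : ρ' ≤ 1) (n₁ n₂ : ℕ) (t : ℝ)
    (hint₁ : ∀ s : SeqOfRecord F ϑ.ν ϑ.τ9.M g₁ p₁.K k₁,
      Integrable (fun U => chiSeqOfRecord F N ϑ.ν ϑ.τ9.M g₁ p₁.K k₁ s U * dressedSlotsOfDatum₉ F N ϑ D g₀ os t p₁ g₁ k₁ s U) (fieldMeasure (F.P p₁.K) k₁ (SU N)))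
    (hint₂ : ∀ s : SeqOfRecord F ϑ.ν ϑ.τ9.M g₂ p₂.K k₂,
      Integrable (fun U => chiSeqOfRecord F N ϑ.ν ϑ.τ9.M g₂ p₂.K k₂ s U * dressedSlotsOfDatum₉ F N ϑ D g₀ os t p₂ g₂ k₂ s U) (fieldMeasure (F.P p₂.K) k₂ (SU N))) :
    ∃ i ∈ Finset.range (n₁ + 1), ∃ j ∈ Finset.range (n₂ + 1),
      ∑ s', topGap2ShellAt F N ϑ D g₀ os p₁ g₁ k₁ (cutGrid ϑ.ν g₁ (k₁ + 1) ρ (i + 2)) (cutGrid ϑ.ν g₁ (k₁ + 1) ρ (i + 1)) (cutGrid ϑ.ν g₁ (k₁ + 1) ρ i)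
          (bCutGrid ϑ.ν ϑ.A₁ g₁ k₁ ρ' (j + 2)) (bCutGrid ϑ.ν ϑ.A₁ g₁ k₁ ρ' (j + 1)) (bCutGrid ϑ.ν ϑ.A₁ g₁ k₁ ρ' j) t s' ≤
          4 * (2 * (F.L : ℝ) ^ F.m) ^ 4 * (1 / (n₁ + 1 : ℕ) + 1 / (n₂ + 1 : ℕ)) * ∑ s, classWeightOfDatum₉ F N ϑ D g₀ os p₁ g₁ k₁ t s ∧
        ∑ s', topGap2ShellAt F N ϑ D g₀ os p₂ g₂ k₂ (cutGrid ϑ.ν g₂ (k₂ + 1) ρ (i + 2)) (cutGrid ϑ.ν g₂ (k₂ + 1) ρ (i + 1)) (cutGrid ϑ.ν g₂ (k₂ + 1) ρ i)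
          (bCutGrid ϑ.ν ϑ.A₁ g₂ k₂ ρ' (j + 2)) (bCutGrid ϑ.ν ϑ.A₁ g₂ k₂ ρ' (j + 1)) (bCutGrid ϑ.ν ϑ.A₁ g₂ k₂ ρ' j) t s' ≤
          4 * (2 * (F.L : ℝ) ^ F.m) ^ 4 * (1 / (n₁ + 1 : ℕ) + 1 / (n₂ + 1 : ℕ)) * ∑ s, classWeightOfDatum₉ F N ϑ D g₀ os p₂ g₂ k₂ t s := by
  -- the a-majorants and the b-majorants of the two runs along their grids
  set fa₁ : ℕ → ℝ := fun i => ∫ U, collarAt F N ϑ.ν p₁ g₁ k₁ (cutGrid ϑ.ν g₁ (k₁ + 1) ρ (i + 2)) (cutGrid ϑ.ν g₁ (k₁ + 1) ρ i) ((avOfRecord F N p₁.K k₁).avg U) *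
    ∑ s, chiSeqOfRecord F N ϑ.ν ϑ.τ9.M g₁ p₁.K k₁ s U * dressedSlotsOfDatum₉ F N ϑ D g₀ os t p₁ g₁ k₁ s U ∂fieldMeasure (F.P p₁.K) k₁ (SU N) with hfa₁
  set fa₂ : ℕ → ℝ := fun i => ∫ U, collarAt F N ϑ.ν p₂ g₂ k₂ (cutGrid ϑ.ν g₂ (k₂ + 1) ρ (i + 2)) (cutGrid ϑ.ν g₂ (k₂ + 1) ρ i) ((avOfRecord F N p₂.K k₂).avg U) *
    ∑ s, chiSeqOfRecord F N ϑ.ν ϑ.τ9.M g₂ p₂.K k₂ s U * dressedSlotsOfDatum₉ F N ϑ D g₀ os t p₂ g₂ k₂ s U ∂fieldMeasure (F.P p₂.K) k₂ (SU N) with hfa₂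
  set fb₁ : ℕ → ℝ := fun j => ∫ U, ∑ s, collarBAt F N ϑ.ν ϑ.τ9.M p₁ g₁ k₁ (bCutGrid ϑ.ν ϑ.A₁ g₁ k₁ ρ' (j + 2)) (bCutGrid ϑ.ν ϑ.A₁ g₁ k₁ ρ' j) s U
      ((avOfRecord F N p₁.K k₁).avg U) * (chiSeqOfRecord F N ϑ.ν ϑ.τ9.M g₁ p₁.K k₁ s U * dressedSlotsOfDatum₉ F N ϑ D g₀ os t p₁ g₁ k₁ s U)
    ∂fieldMeasure (F.P p₁.K) k₁ (SU N) with hfb₁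
  set fb₂ : ℕ → ℝ := fun j => ∫ U, ∑ s, collarBAt F N ϑ.ν ϑ.τ9.M p₂ g₂ k₂ (bCutGrid ϑ.ν ϑ.A₁ g₂ k₂ ρ' (j + 2)) (bCutGrid ϑ.ν ϑ.A₁ g₂ k₂ ρ' j) s U
      ((avOfRecord F N p₂.K k₂).avg U) * (chiSeqOfRecord F N ϑ.ν ϑ.τ9.M g₂ p₂.K k₂ s U * dressedSlotsOfDatum₉ F N ϑ D g₀ os t p₂ g₂ k₂ s U)
    ∂fieldMeasure (F.P p₂.K) k₂ (SU N) with hfb₂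
  set Z₁ : ℝ := ∑ s, classWeightOfDatum₉ F N ϑ D g₀ os p₁ g₁ k₁ t s with hZ₁
  set Z₂ : ℝ := ∑ s, classWeightOfDatum₉ F N ϑ D g₀ os p₂ g₂ k₂ t s with hZ₂
  set X : ℝ := (2 * (F.L : ℝ) ^ F.m) ^ 4 with hX
  -- signs of the majorants (ANY sign of the bases) and their counts along the grids
  have hfa₁0 : ∀ i ∈ Finset.range (n₁ + 1), 0 ≤ fa₁ i := fun i _ => majorantA_grid_nonneg F N ϑ D g₀ os p₁ g₁ k₁ hζ0 (k₁ + 1) hρ0 hρ1 i t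
  have hfa₂0 : ∀ i ∈ Finset.range (n₁ + 1), 0 ≤ fa₂ i := fun i _ => majorantA_grid_nonneg F N ϑ D g₀ os p₂ g₂ k₂ hζ0 (k₂ + 1) hρ0 hρ1 i t
  have hfb₁0 : ∀ j ∈ Finset.range (n₂ + 1), 0 ≤ fb₁ j := fun j _ => majorantB_grid_nonneg F N ϑ D g₀ os p₁ g₁ k₁ hζ0 k₁ hρ'0 hρ'1 j t
  have hfb₂0 : ∀ j ∈ Finset.range (n₂ + 1), 0 ≤ fb₂ j := fun j _ => majorantB_grid_nonneg F N ϑ D g₀ os p₂ g₂ k₂ hζ0 k₂ hρ'0 hρ'1 j t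
  have hsa₁ : ∑ i ∈ Finset.range (n₁ + 1), fa₁ i ≤ 2 * X * Z₁ := sum_range_majorantA_le F N ϑ D g₀ os p₁ g₁ k₁ hk₁ hζ0 ρ (n₁ + 1) t hint₁
  have hsa₂ : ∑ i ∈ Finset.range (n₁ + 1), fa₂ i ≤ 2 * X * Z₂ := sum_range_majorantA_le F N ϑ D g₀ os p₂ g₂ k₂ hk₂ hζ0 ρ (n₁ + 1) t hint₂
  have hsb₁ : ∑ j ∈ Finset.range (n₂ + 1), fb₁ j ≤ 2 * X * Z₁ := sum_range_majorantB_le F N ϑ D g₀ os p₁ g₁ k₁ hk₁ hζ0 ρ' (n₂ + 1) t hint₁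
  have hsb₂ : ∑ j ∈ Finset.range (n₂ + 1), fb₂ j ≤ 2 * X * Z₂ := sum_range_majorantB_le F N ϑ D g₀ os p₂ g₂ k₂ hk₂ hζ0 ρ' (n₂ + 1) t hint₂
  -- two independent common argmins
  obtain ⟨i, hi, hia₁, hia₂⟩ := exists_common_single_le hfa₁0 hfa₂0 hsa₁ hsa₂
  obtain ⟨j, hj, hjb₁, hjb₂⟩ := exists_common_single_le hfb₁0 hfb₂0 hsb₁ hsb₂
  -- §SF3 in each run at the selected letters
  have hM₁ := sum_topGap2ShellAt_grids_le_majorants F N ϑ D g₀ os p₁ g₁ k₁ hk₁ hζ0 hζm hζ1 hζu hρ0 hρ1 hρ'0 hρ'1 (k₁ + 1) k₁ i j t hint₁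
  have hM₂ := sum_topGap2ShellAt_grids_le_majorants F N ϑ D g₀ os p₂ g₂ k₂ hk₂ hζ0 hζm hζ1 hζu hρ0 hρ1 hρ'0 hρ'1 (k₂ + 1) k₂ i j t hint₂
  have hnum : ∀ Z : ℝ, 2 * (2 * X) / (n₁ + 1 : ℕ) * Z + 2 * (2 * X) / (n₂ + 1 : ℕ) * Z = 4 * X * (1 / (n₁ + 1 : ℕ) + 1 / (n₂ + 1 : ℕ)) * Z := fun Z => by ring
  refine ⟨i, hi, j, hj, ?_, ?_⟩
  · calc _ ≤ fa₁ i + fb₁ j := hM₁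
      _ ≤ 2 * (2 * X) / (n₁ + 1 : ℕ) * Z₁ + 2 * (2 * X) / (n₂ + 1 : ℕ) * Z₁ := add_le_add hia₁ hjb₁
      _ = 4 * X * (1 / (n₁ + 1 : ℕ) + 1 / (n₂ + 1 : ℕ)) * Z₁ := hnum Z₁
  · calc _ ≤ fa₂ i + fb₂ j := hM₂
      _ ≤ 2 * (2 * X) / (n₁ + 1 : ℕ) * Z₂ + 2 * (2 * X) / (n₂ + 1 : ℕ) * Z₂ := add_le_add hia₂ hjb₂
      _ = 4 * X * (1 / (n₁ + 1 : ℕ) + 1 / (n₂ + 1 : ℕ)) * Z₂ := hnum Z₂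

end SelectSF

end Summit.QuantumFields.YangMills.Theorems.N21GappedTopPair13CoPH

end
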